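import Literature.Analysis.FunctionSpaces.LittlewoodPaleyEllipticBlock
import Literature.Analysis.FunctionSpaces.LittlewoodPaleyLowFrequencyDeriv
import Literature.Analysis.FunctionSpaces.LittlewoodPaleyBesovHolderQuant
import Literature.Analysis.FunctionSpaces.TemperedDistributionClassicalDeriv
import Literature.Analysis.FunctionSpaces.LittlewoodPaleyHolderDirect
import HarnessLib

/-!
# The constant-coefficient Schauder estimate for the Laplacian on `ℝⁿ` (Schauder program, A′ assembly)

Topic `Literature/Analysis/FunctionSpaces`. For `u ∈ C²_b(E, F)` (`E` a finite-dimensional real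
inner product space, `F` a complex Banach space) whose Laplacian `Δu = ∑ᵢ D²u(eᵢ, eᵢ)` is
`α`-Hölder, `0 < α < 1`, every second directional derivative `x ↦ D²u(x)(a, b)` is `α`-Hölder with

  `[D²u(a, b)]_α ≤ C_{ab} (‖u‖_∞ + [Δu]_α)`,

`C_{ab}` depending only on `a, b, α` and `E` (Gilbarg–Trudinger 2001, Thm. 4.8 / Cor. 4.9 — here by
Littlewood–Paley theory instead of the Newtonian potential): with `U = [u] ∈ 𝓢'(E, F)` and
`W = ∂_a ∂_b U = [D²u(a, b)]` (distributional = classical derivatives, A′3),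
`‖Ṡ₀ W‖_∞ ≤ C‖u‖_∞` (A′2), `2^{jα}‖Δ̇_j W‖_∞ ≲ 2^{j(2+α)}‖Δ̇_j U‖_∞ ≲ 2^{jα}‖Δ̇_j [Δu]‖_∞ ≲ [Δu]_α`
(Bernstein ×2, the elliptic block estimate A′1, vanishing moments of the block kernels), and the
quantitative Besov → Hölder estimate (A′4) for `W`, whose continuous representative is `D²u(a, b)`.

* `exists_schauder_const_laplacian_direction` — the estimate above.

Census item (2a) of `Literature.Geometry.Riemannian.gurskyViaclovsky_pathOpen_weighted_four`.
Everything is proved; no named facts.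

## References

* D. Gilbarg, N. S. Trudinger, *Elliptic Partial Differential Equations of Second Order* (2001),
  Thm. 4.8, Cor. 4.9. [GilbargTrudinger2001]
* H. Triebel, *Theory of Function Spaces* (1983), Thm. 2.5.7. [Triebel1983]
-/

noncomputable section

open MeasureTheory FourierTransform SchwartzMap Real Filter Topology Function TemperedDistribution
open scoped SchwartzMap ENNReal NNReal FourierTransform RealInnerProductSpace ContDiff
open scoped LineDeriv Laplacian

namespace Literature.Analysis.FunctionSpaces

variable {E : Type*} [NormedAddCommGroup E] [InnerProductSpace ℝ E] [FiniteDimensional ℝ E]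
  [MeasurableSpace E] [BorelSpace E] {F : Type*} [NormedAddCommGroup F] [NormedSpace ℂ F]
  [CompleteSpace F]

/-! ### Bookkeeping lemmas -/

/-- Two `L^∞` functions with the same tempered distribution agree a.e. [folklore] -/
theorem ae_eq_of_coe_toLp_eq {f g : E → F} (hf : MemLp f ∞ (volume : Measure E))
    (hg : MemLp g ∞ (volume : Measure E))
    (h : ((hf.toLp f : Lp F ∞ (volume : Measure E)) : 𝓢'(E, F)) =
      ((hg.toLp g : Lp F ∞ (volume : Measure E)) : 𝓢'(E, F))) :
    f =ᵐ[volume] g := by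
  have hinj : Function.Injective (Lp.toTemperedDistributionCLM F (volume : Measure E) ∞) :=
    LinearMap.ker_eq_bot.1 Lp.ker_toTemperedDistributionCLM_eq_bot
  have h1 : hf.toLp f = hg.toLp g := hinj h
  exact (MemLp.toLp_eq_toLp_iff hf hg).1 h1

omit [FiniteDimensional ℝ E] [MeasurableSpace E] [BorelSpace E] [CompleteSpace F] in
/-- The second directional derivative as an iterated derivative:
`D(x ↦ Du(x) b)(x) a = D²u(x)(a, b)`. [folklore] -/
theorem fderiv_fderiv_apply_eq_iteratedFDeriv_two' {u : E → F} (hu : ContDiff ℝ 2 u) (a b x : E) :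
    fderiv ℝ (fun y => fderiv ℝ u y b) x a = iteratedFDeriv ℝ 2 u x ![a, b] := by
  have hd : DifferentiableAt ℝ (fderiv ℝ u) x :=
    ((hu.fderiv_right (m := 1) (by norm_num)).differentiable one_ne_zero x)
  rw [fderiv_clm_apply hd (differentiableAt_const b), iteratedFDeriv_two_apply]
  simp

/-- The `L^∞` norm of the distribution of a bounded function. [folklore] -/
theorem eLpNormDistrib_coe_toLp_le_ofReal {f : E → F} (hf : MemLp f ∞ (volume : Measure E))
    {M : ℝ} (hM : ∀ x, ‖f x‖ ≤ M) :
    eLpNormDistrib ∞ ((hf.toLp f : Lp F ∞ (volume : Measure E)) : 𝓢'(E, F)) ≤ ENNReal.ofReal M := by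
  rw [eLpNormDistrib_coe, Lp.enorm_def, eLpNorm_congr_ae hf.coeFn_toLp, eLpNorm_exponent_top]
  exact eLpNormEssSup_le_of_ae_bound (Eventually.of_forall hM)

/-- **The constant-coefficient Schauder estimate for `Δ` on `ℝⁿ`, directional form.** For
`0 < α < 1` and `a, b ∈ E` there is `C < ∞` such that for every `u ∈ C²_b(E, F)` (bounded with
bounded first and second derivatives) whose Laplacian `Δu` is `α`-Hölder with constant `CΔ`,

  `‖D²u(x)(a,b) − D²u(y)(a,b)‖ ≤ C (‖u‖_∞ + CΔ) ‖x − y‖^α`.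

[cite: GilbargTrudinger2001, Thm. 4.8] -/
theorem exists_schauder_const_laplacian_direction {α : ℝ≥0} (hα0 : 0 < α) (hα1 : α < 1)
    (a b : E) :
    ∃ C : ℝ≥0∞, C < ⊤ ∧ ∀ (u : E → F) (M₀ M₁ M₂ : ℝ) (CΔ : ℝ≥0),
      ContDiff ℝ 2 u → (∀ x, ‖u x‖ ≤ M₀) → (∀ x, ‖fderiv ℝ u x‖ ≤ M₁) →
      (∀ x, ‖iteratedFDeriv ℝ 2 u x‖ ≤ M₂) → HolderWith CΔ α (Δ u) →
      ∀ x y, edist (iteratedFDeriv ℝ 2 u x ![a, b]) (iteratedFDeriv ℝ 2 u y ![a, b]) ≤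
        C * (ENNReal.ofReal M₀ + CΔ) * edist x y ^ (α : ℝ) := by
  have hα0' : (0 : ℝ) < α := hα0
  -- the u-independent constants
  obtain ⟨CL, hCL⟩ := exists_eLpNormDistrib_lineDeriv_lpBlock_le (E := E) (F := F) ∞
  obtain ⟨CE, hCE⟩ := exists_eLpNormDistrib_lpBlock_le_laplacian (E := E) (F := F) ∞
  obtain ⟨C₀, hC₀top, hC₀⟩ :=
    exists_eLpNormDistrib_lineDeriv_lineDeriv_lowFreqCutoff_le (E := E) (F := F) ∞ 0 a b
  obtain ⟨K₁, K₂, hK₁top, hK₂top, hBH⟩ :=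
    exists_memContDiffHolder_coe_eq_of_memBesov_top_top_quant (E := E) (F := F) 0 hα0 hα1
  set I : ℝ := ∫ z, ‖blockKernel E 0 z‖ * ‖z‖ ^ (((0 : ℕ) : ℝ) + (α : ℝ)) with hI
  have hI0 : 0 ≤ I := integral_nonneg fun z => by positivity
  set Cmid : ℝ≥0∞ := (CL : ℝ≥0∞) * CL * CE * ENNReal.ofReal (‖a‖ * ‖b‖) with hCmid
  have hCmidtop : Cmid < ⊤ := by
    refine ENNReal.mul_lt_top (ENNReal.mul_lt_top (ENNReal.mul_lt_top ?_ ?_) ?_) ENNReal.ofReal_lt_top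
      <;> exact ENNReal.coe_lt_top
  set C : ℝ≥0∞ := K₂ * (C₀ + Cmid * ENNReal.ofReal I) with hC
  have hCtop : C < ⊤ := ENNReal.mul_lt_top hK₂top
    (ENNReal.add_lt_top.2 ⟨hC₀top, ENNReal.mul_lt_top hCmidtop ENNReal.ofReal_lt_top⟩)
  refine ⟨C, hCtop, fun u M₀ M₁ M₂ CΔ hu hM₀ hM₁ hM₂ hΔ x y => ?_⟩
  -- Step 1: `L^∞` memberships of `u`, `Du·m`, `D²u(m, m')`, `Δu`
  have huc : Continuous u := hu.continuous
  have hu1 : ContDiff ℝ 1 u := hu.of_le (by norm_num)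
  have hDuc : Continuous (fderiv ℝ u) := hu.continuous_fderiv (by norm_num)
  have hD2c : Continuous (iteratedFDeriv ℝ 2 u) := hu.continuous_iteratedFDeriv le_rfl
  have hu0 : MemLp u ∞ (volume : Measure E) :=
    memLp_top_of_bound huc.aestronglyMeasurable M₀ (Eventually.of_forall hM₀)
  have hum : ∀ m : E, MemLp (fun x => fderiv ℝ u x m) ∞ (volume : Measure E) := fun m =>
    memLp_top_of_bound (hDuc.clm_apply continuous_const).aestronglyMeasurable (M₁ * ‖m‖)
      (Eventually.of_forall fun x => ((fderiv ℝ u x).le_opNorm m).trans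
        (mul_le_mul_of_nonneg_right (hM₁ x) (norm_nonneg _)))
  set w : E → E → E → F := fun m m' x => iteratedFDeriv ℝ 2 u x ![m, m'] with hw
  have hwc : ∀ m m', Continuous (w m m') := fun m m' =>
    (continuous_eval_const (![m, m'] : Fin 2 → E)).comp hD2c
  have hwb : ∀ m m' x, ‖w m m' x‖ ≤ M₂ * (‖m‖ * ‖m'‖) := fun m m' x => by
    have h := (iteratedFDeriv ℝ 2 u x).le_opNorm ![m, m']
    rw [Fin.prod_univ_two] at h
    simp only [Matrix.cons_val_zero, Matrix.cons_val_one] at h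
    exact h.trans (mul_le_mul_of_nonneg_right (hM₂ x) (by positivity))
  have hwmem : ∀ m m', MemLp (w m m') ∞ (volume : Measure E) := fun m m' =>
    memLp_top_of_bound (hwc m m').aestronglyMeasurable _ (Eventually.of_forall (hwb m m'))
  have hwfun : ∀ m m', (fun x => fderiv ℝ (fun y => fderiv ℝ u y m') x m) = w m m' := fun m m' =>
    funext fun x => fderiv_fderiv_apply_eq_iteratedFDeriv_two' hu m m' x
  have hum2 : ∀ m m', MemLp (fun x => fderiv ℝ (fun y => fderiv ℝ u y m') x m) ∞ (volume : Measure E) :=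
    fun m m' => by rw [hwfun m m']; exact hwmem m m'
  -- the Laplacian: continuity and boundedness
  set bE := stdOrthonormalBasis ℝ E with hbE
  have hΔeq : Δ u = fun x => ∑ i, w (bE i) (bE i) x := by
    rw [InnerProductSpace.laplacian_eq_iteratedFDeriv_orthonormalBasis u bE]
  have hΔc : Continuous (Δ u) := by
    rw [hΔeq]
    exact continuous_finsetSum _ fun i _ => hwc _ _
  set MΔ : ℝ := ∑ i : Fin (Module.finrank ℝ E), M₂ * (‖bE i‖ * ‖bE i‖) with hMΔ
  have hΔb : ∀ x, ‖Δ u x‖ ≤ MΔ := fun x => by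
    rw [hΔeq]
    exact (norm_sum_le _ _).trans (Finset.sum_le_sum fun i _ => hwb _ _ x)
  have hΔmem : MemLp (Δ u) ∞ (volume : Measure E) :=
    memLp_top_of_bound hΔc.aestronglyMeasurable MΔ (Eventually.of_forall hΔb)
  -- Step 2: the distributions `U = [u]`, `W = ∂_a ∂_b U = [w a b]`, `Δ U = [Δ u]`
  set U : 𝓢'(E, F) := ((hu0.toLp u : Lp F ∞ (volume : Measure E)) : 𝓢'(E, F)) with hU
  have hΔU : Δ U = ((hΔmem.toLp _ : Lp F ∞ (volume : Measure E)) : 𝓢'(E, F)) :=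
    laplacian_coe_toLp_eq hu hu0 hum (fun m => hum2 m m) hΔmem
  have hbU : ∂_{b} U = (((hum b).toLp _ : Lp F ∞ (volume : Measure E)) : 𝓢'(E, F)) :=
    lineDerivOp_coe_toLp_eq hu1 b hu0 (hum b)
  have hub1 : ContDiff ℝ 1 fun y => fderiv ℝ u y b :=
    (hu.fderiv_right (m := 1) (by norm_num)).clm_apply contDiff_const
  have hW : ∂_{a} (∂_{b} U) = (((hum2 a b).toLp _ : Lp F ∞ (volume : Measure E)) : 𝓢'(E, F)) := by
    rw [hbU]
    exact lineDerivOp_coe_toLp_eq hub1 a (hum b) (hum2 a b)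
  set W : 𝓢'(E, F) := ∂_{a} (∂_{b} U) with hWdef
  -- Step 3: the low-frequency bound `‖Ṡ₀ W‖_∞ ≤ C₀ ‖u‖_∞`
  have hS : eLpNormDistrib ∞ (lowFreqCutoff 0 W) ≤ C₀ * ENNReal.ofReal M₀ := by
    rw [hWdef, lowFreqCutoff_lineDeriv_comm, lowFreqCutoff_lineDeriv_comm]
    refine (hC₀ U).trans ?_
    gcongr
    exact eLpNormDistrib_coe_toLp_le_ofReal hu0 hM₀
  -- Step 4: the block bounds `2^{jα} ‖Δ̇_j W‖_∞ ≤ Cmid · CΔ I`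
  have hΔblk : ∀ j : ℤ, eLpNormDistrib ∞ (lpBlock j (Δ U)) ≤
      ENNReal.ofReal ((CΔ : ℝ) * (2 : ℝ) ^ (-(j : ℝ) * (((0 : ℕ) : ℝ) + (α : ℝ))) * I) := by
    intro j
    rw [hΔU]
    refine eLpNormDistrib_lpBlock_coe_le_of_bound hΔmem j fun z => ?_
    have hH : HolderWith CΔ α (iteratedFDeriv ℝ 0 (Δ u)) := holderWith_iteratedFDeriv_zero_iff.2 hΔ
    have hc0 : ContDiff ℝ ((0 : ℕ) : ℕ∞) (Δ u) := by exact_mod_cast contDiff_zero.2 hΔc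
    have h := norm_blockFn_le_two_rpow_neg (k := 0) hc0 hH hΔb j z
    simpa only [mul_assoc] using h
  have hblk : ∀ j : ℤ, (2 : ℝ≥0∞) ^ ((j : ℝ) * α) * eLpNormDistrib ∞ (lpBlock j W) ≤
      Cmid * ENNReal.ofReal ((CΔ : ℝ) * I) := by
    intro j
    -- `Δ̇_j W = ∂_a Δ̇_j (∂_b U)`, `Δ̇_j ∂_b U = ∂_b Δ̇_j U`
    have h1 : eLpNormDistrib ∞ (lpBlock j W) ≤
        CL * ENNReal.ofReal ((2 : ℝ) ^ j * ‖a‖) * eLpNormDistrib ∞ (lpBlock j (∂_{b} U)) := by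
      rw [hWdef, lpBlock_lineDeriv_comm]
      exact hCL a j _
    have h2 : eLpNormDistrib ∞ (lpBlock j (∂_{b} U)) ≤
        CL * ENNReal.ofReal ((2 : ℝ) ^ j * ‖b‖) * eLpNormDistrib ∞ (lpBlock j U) := by
      rw [lpBlock_lineDeriv_comm]
      exact hCL b j _
    have h3 := hCE j U
    have h4 := hΔblk j
    -- normalise the powers of two
    have h2j : ENNReal.ofReal ((2 : ℝ) ^ j * ‖a‖) = (2 : ℝ≥0∞) ^ ((j : ℝ)) * ENNReal.ofReal ‖a‖ := by
      rw [ENNReal.ofReal_mul (zpow_nonneg zero_le_two _), ofReal_two_zpow]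
    have h2j' : ENNReal.ofReal ((2 : ℝ) ^ j * ‖b‖) = (2 : ℝ≥0∞) ^ ((j : ℝ)) * ENNReal.ofReal ‖b‖ := by
      rw [ENNReal.ofReal_mul (zpow_nonneg zero_le_two _), ofReal_two_zpow]
    have h4' : ENNReal.ofReal ((CΔ : ℝ) * (2 : ℝ) ^ (-(j : ℝ) * (((0 : ℕ) : ℝ) + (α : ℝ))) * I) =
        (CΔ : ℝ≥0∞) * (2 : ℝ≥0∞) ^ (-(j : ℝ) * α) * ENNReal.ofReal I := by
      rw [ENNReal.ofReal_mul (by positivity), ENNReal.ofReal_mul (NNReal.coe_nonneg _),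
        ENNReal.ofReal_coe_nnreal, ← ENNReal.ofReal_rpow_of_pos two_pos, ENNReal.ofReal_ofNat]
      simp
    rw [h2j] at h1
    rw [h2j'] at h2
    rw [h4'] at h4
    have hpow : (2 : ℝ≥0∞) ^ ((j : ℝ) * α) * (2 : ℝ≥0∞) ^ ((j : ℝ)) * (2 : ℝ≥0∞) ^ ((j : ℝ)) *
        (2 : ℝ≥0∞) ^ ((j : ℝ) * (-2)) * (2 : ℝ≥0∞) ^ (-(j : ℝ) * α) = 1 := by
      rw [two_rpow_mul_two_rpow, two_rpow_mul_two_rpow, two_rpow_mul_two_rpow, two_rpow_mul_two_rpow,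
        show (j : ℝ) * α + (j : ℝ) + (j : ℝ) + (j : ℝ) * (-2) + -(j : ℝ) * α = 0 by ring,
        ENNReal.rpow_zero]
    calc (2 : ℝ≥0∞) ^ ((j : ℝ) * α) * eLpNormDistrib ∞ (lpBlock j W)
        ≤ (2 : ℝ≥0∞) ^ ((j : ℝ) * α) * ((CL : ℝ≥0∞) * ((2 : ℝ≥0∞) ^ ((j : ℝ)) * ENNReal.ofReal ‖a‖) *
            eLpNormDistrib ∞ (lpBlock j (∂_{b} U))) := by gcongr
      _ ≤ (2 : ℝ≥0∞) ^ ((j : ℝ) * α) * ((CL : ℝ≥0∞) * ((2 : ℝ≥0∞) ^ ((j : ℝ)) * ENNReal.ofReal ‖a‖) *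
            ((CL : ℝ≥0∞) * ((2 : ℝ≥0∞) ^ ((j : ℝ)) * ENNReal.ofReal ‖b‖) *
              eLpNormDistrib ∞ (lpBlock j U))) := by gcongr
      _ ≤ (2 : ℝ≥0∞) ^ ((j : ℝ) * α) * ((CL : ℝ≥0∞) * ((2 : ℝ≥0∞) ^ ((j : ℝ)) * ENNReal.ofReal ‖a‖) *
            ((CL : ℝ≥0∞) * ((2 : ℝ≥0∞) ^ ((j : ℝ)) * ENNReal.ofReal ‖b‖) *
              ((CE : ℝ≥0∞) * (2 : ℝ≥0∞) ^ ((j : ℝ) * (-2)) * eLpNormDistrib ∞ (lpBlock j (Δ U))))) := by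
          gcongr
      _ ≤ (2 : ℝ≥0∞) ^ ((j : ℝ) * α) * ((CL : ℝ≥0∞) * ((2 : ℝ≥0∞) ^ ((j : ℝ)) * ENNReal.ofReal ‖a‖) *
            ((CL : ℝ≥0∞) * ((2 : ℝ≥0∞) ^ ((j : ℝ)) * ENNReal.ofReal ‖b‖) *
              ((CE : ℝ≥0∞) * (2 : ℝ≥0∞) ^ ((j : ℝ) * (-2)) *
                ((CΔ : ℝ≥0∞) * (2 : ℝ≥0∞) ^ (-(j : ℝ) * α) * ENNReal.ofReal I)))) := by
          gcongr
      _ = Cmid * ((CΔ : ℝ≥0∞) * ENNReal.ofReal I) *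
            ((2 : ℝ≥0∞) ^ ((j : ℝ) * α) * (2 : ℝ≥0∞) ^ ((j : ℝ)) * (2 : ℝ≥0∞) ^ ((j : ℝ)) *
              (2 : ℝ≥0∞) ^ ((j : ℝ) * (-2)) * (2 : ℝ≥0∞) ^ (-(j : ℝ) * α)) := by
          rw [hCmid, ENNReal.ofReal_mul (norm_nonneg _)]
          ring
      _ = Cmid * ENNReal.ofReal ((CΔ : ℝ) * I) := by
          rw [hpow, mul_one, ENNReal.ofReal_mul (NNReal.coe_nonneg _), ENNReal.ofReal_coe_nnreal]
  -- Step 5: `W ∈ B^α_{∞,∞}` with `N(W) ≤ Cmid · CΔ I`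
  have hN : eLpNorm (lpBlockWeightSucc (((0 : ℕ) : ℝ) + (α : ℝ)) ∞ W) ∞ Measure.count ≤
      Cmid * ENNReal.ofReal ((CΔ : ℝ) * I) := by
    rw [eLpNorm_exponent_top, eLpNormEssSup_count]
    refine iSup_le fun n => ?_
    simp only [enorm_eq_self, lpBlockWeightSucc, lpBlockWeight, Nat.cast_zero, zero_add]
    exact hblk _
  have hWB : MemBesov (((0 : ℕ) : ℝ) + (α : ℝ)) ∞ ∞ W := by
    rw [MemBesov, eBesovNorm]
    refine ENNReal.add_lt_top.2 ⟨hS.trans_lt (ENNReal.mul_lt_top hC₀top ENNReal.ofReal_lt_top),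
      hN.trans_lt (ENNReal.mul_lt_top hCmidtop ENNReal.ofReal_lt_top)⟩
  -- Step 6: the Hölder representative of `W` is `D²u(a, b)`
  obtain ⟨f, hf, hfmem, hfrep, -, hfH⟩ := hBH W hWB
  have hfc : Continuous f := by
    have h := hfmem.contDiff.continuous
    exact h
  have hfeq : f = w a b := by
    have hae : f =ᵐ[volume] fun x => fderiv ℝ (fun y => fderiv ℝ u y b) x a :=
      ae_eq_of_coe_toLp_eq hf (hum2 a b) (hfrep.trans hW)
    rw [hwfun a b] at hae
    exact (hfc.ae_eq_iff_eq volume (hwc a b)).1 hae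
  -- Step 7: conclusion
  have hmain := hfH x y
  rw [iteratedFDeriv_zero_eq_comp, Function.comp_apply, Function.comp_apply,
    LinearIsometryEquiv.edist_map, hfeq] at hmain
  refine hmain.trans (mul_le_mul' ?_ le_rfl)
  -- `K₂ (S + N) ≤ C (‖u‖_∞ + CΔ)`
  have hSN : eLpNormDistrib ∞ (lowFreqCutoff 0 W) +
      eLpNorm (lpBlockWeightSucc (((0 : ℕ) : ℝ) + (α : ℝ)) ∞ W) ∞ Measure.count ≤
      (C₀ + Cmid * ENNReal.ofReal I) * (ENNReal.ofReal M₀ + CΔ) := by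
    refine (add_le_add hS hN).trans ?_
    rw [ENNReal.ofReal_mul (NNReal.coe_nonneg _), ENNReal.ofReal_coe_nnreal, add_mul]
    refine add_le_add ?_ ?_
    · gcongr
      exact le_self_add
    · calc Cmid * ((CΔ : ℝ≥0∞) * ENNReal.ofReal I) = Cmid * ENNReal.ofReal I * CΔ := by ring
        _ ≤ Cmid * ENNReal.ofReal I * (ENNReal.ofReal M₀ + CΔ) := by
            gcongr
            exact le_add_self
  rw [hC, mul_assoc]
  gcongr

end Literature.Analysis.FunctionSpaces

end
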